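import Summits.AnomalousDissipation.AnomalousDissipation.Theorems.TameClosure.Negative.EscapingAtom
import HarnessLib

/-!
# Stub `stub_energyIdle` of line `Sketch` (crux stmt-AnomalousDissipation-17938, `EnsembleRigidity.GPTameDefectFloor`) — the energy level is idle (sharp Poincaré)

A tame defect floor proved at the Poincaré energy level `E₀ = max(G₁, 0) / (4π²)` is a tame defect
floor at EVERY energy level `E`, with the same radius `r`.

On the energy space `H = L²_σ(T³)` (mean-zero solenoidal fields, Fourier support in `|k|² ≥ 1`) the
sharp Poincaré inequality `4π² |v|² ≤ ‖∇v‖²` holds pointwise; integrating it against a probability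
measure `μ` on `H` with integrable energy and mean enstrophy `∫⁻ ‖∇v‖² dμ ≤ ofReal G₁` gives
`4π² ∫ |v|² dμ ≤ max(G₁, 0)` (landed as
`TameClosure.Negative.ensembleEnergy_le_of_ensembleEnstrophy_le`). Hence every measure admitted at the
level `(E, G₁)` is already admitted at the level `(E₀, G₁)`, and the floor statement (no Φ-uniform
cylindrical forced-Euler defect `≤ r`) transfers verbatim: the energy hypothesis `∫ |v|² dμ ≤ E` of the
conclusion is simply not used.

## Proof

`intro`; feed the hypothesis with the same measure, the probability / integrability / enstrophy data, and
the energy bound `∫ |v|² dμ ≤ max(G₁,0)/(4π²)` obtained from the Poincaré lemma by `le_div_iff₀` and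
linear arithmetic.

## References

* C. Foias, O. Manley, R. Rosa, R. Temam, *Navier–Stokes Equations and Turbulence* (CUP 2001),
  Ch. II (Poincaré inequality on the periodic space `H`), Ch. IV §1.
* R. Rosa, R. Temam, arXiv:2010.06730 (stationary statistical solutions, energy/enstrophy levels).
-/

-- `Summit.<Summit>.<Problem>` is the tree's mandated summit-side namespace (CONVENTIONS §2); single-conjunct summit, duplicate deliberate.
set_option linter.dupNamespace false

noncomputable section

namespace Summit.AnomalousDissipation.AnomalousDissipation.Theorems.EnsembleRigidity.GPTameDefectFloor

open MeasureTheory Filter Topology UnitAddTorus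
open scoped InnerProductSpace RealInnerProductSpace ENNReal NNReal
open Literature.Analysis.FunctionSpaces Literature.Analysis.FluidPDE
open Summit.AnomalousDissipation.AnomalousDissipation.Theorems.EnsembleRigidity

/-- Local notation: real vector fields on `T³`. -/
local notation "Vec3" => (UnitAddTorus (Fin 3)) → (EuclideanSpace ℝ (Fin 3))
/-- Local notation: `L²(T³; ℝ³)`. -/
local notation "L2" => (Lp (EuclideanSpace ℝ (Fin 3)) 2 (volume : Measure (UnitAddTorus (Fin 3))))
/-- Local notation: the energy space `H`. -/
local notation "H3" => (Torus.energySpace (Fin 3))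

/-- **Poincaré energy bound of a tame ensemble, divided form.** A probability measure on `H` with
integrable energy and mean enstrophy `≤ ofReal G₁` has mean energy `≤ max(G₁, 0) / (4π²)`
(`4π² |v|² ≤ ‖∇v‖²` on `H`, integrated). [folklore] -/
theorem idle_ensembleEnergy_le_div (μ : Measure H3) (hint : Integrable (fun v : H3 => ‖v‖ ^ 2) μ)
    {G₁ : ℝ} (hG : Torus.ensembleEnstrophy μ ≤ ENNReal.ofReal G₁) :
    Torus.ensembleEnergy μ ≤ max G₁ 0 / (4 * Real.pi ^ 2) := by
  have hpi : 0 < Real.pi := Real.pi_pos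
  have key :=
    Summit.AnomalousDissipation.AnomalousDissipation.Theorems.TameClosure.Negative.ensembleEnergy_le_of_ensembleEnstrophy_le
      μ hint hG
  rw [le_div_iff₀ (by positivity)]
  linarith

/-- **Stub `stub_energyIdle`** — THE ENERGY LEVEL IS IDLE. A tame defect floor of radius `r` at the
Poincaré level `E₀ = max(G₁, 0)/(4π²)` is a tame defect floor of the same radius at every energy level
`E`: every probability measure on `H` with integrable energy and `∫⁻ ‖∇v‖² dμ ≤ ofReal G₁` has
`∫ |v|² dμ ≤ max(G₁, 0)/(4π²)` by the sharp Poincaré inequality `4π² |v|² ≤ ‖∇v‖²` on `H`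
(`TameClosure.Negative.ensembleEnergy_le_of_ensembleEnstrophy_le`), so the hypothesis applies to it
directly; the energy bound `∫ |v|² dμ ≤ E` is not needed. [folklore] -/
theorem stub_energyIdle : ∀ (f : Vec3) (E G₁ r : ℝ), (∀ μ : Measure H3, IsProbabilityMeasure μ → Integrable (fun v : H3 => ‖v‖ ^ 2) μ → Torus.ensembleEnergy μ ≤ max G₁ 0 / (4 * Real.pi ^ 2) → Torus.ensembleEnstrophy μ ≤ ENNReal.ofReal G₁ → ¬ (∀ Φ : Torus.CylindricalTest (Fin 3), Integrable (fun v : H3 => Torus.nsGeneratorPairing 0 f v (Φ.grad v)) μ ∧ |∫ v, Torus.nsGeneratorPairing 0 f v (Φ.grad v) ∂μ| ≤ r * Real.sqrt (∫ v, Torus.gradNormSq (Φ.grad v) ∂μ))) → ∀ μ : Measure H3, IsProbabilityMeasure μ → Integrable (fun v : H3 => ‖v‖ ^ 2) μ → Torus.ensembleEnergy μ ≤ E → Torus.ensembleEnstrophy μ ≤ ENNReal.ofReal G₁ → ¬ (∀ Φ : Torus.CylindricalTest (Fin 3), Integrable (fun v : H3 => Torus.nsGeneratorPairing 0 f v (Φ.grad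 v)) μ ∧ |∫ v, Torus.nsGeneratorPairing 0 f v (Φ.grad v) ∂μ| ≤ r * Real.sqrt (∫ v, Torus.gradNormSq (Φ.grad v) ∂μ)) := by
  intro f _E G₁ r h μ hμ hint _hE hG
  exact h μ hμ hint (idle_ensembleEnergy_le_div μ hint hG) hG

end Summit.AnomalousDissipation.AnomalousDissipation.Theorems.EnsembleRigidity.GPTameDefectFloor

end
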